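/-
Copyright: cell `pub-ymgap` (HUMAN RULING D-0062), Track A of `YM-PLAN.md`, DAG node N20 (= NE7b); R134 acceleration seat
`pub-ymgap-dag-n20-d` (generation 3), module 6.  Released under the licence of the surrounding project.
-/
import Summits.QuantumFields.YangMills.Theorems.BalabanUVNodesN20LCSAvgCellPeierls
import HarnessLib

/-!
# YM-DAG node N20 (= NE7b): THE (LS) TRANSFER RULE FOR BAŁABAN'S (0.4) AVERAGING AT ANY LEVEL AND UNDER ANY STATE — local exponential plaquette
# moments of a finite measure `ν` on the level-`j` fields ⇒ local exponential plaquette moments of the averaged field `Ū = avgFun expMeanLogSU U`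
# under the SAME `ν`, with explicit constants; and the Peierls consequence under `ν`

Track A of `YM-PLAN.md` (cell `pub-ymgap`, HUMAN RULING D-0062), node **N20** = spine estimate NE7b (`T4WeightBudget.RelWeightBound`, NOT PRINTED,
NOT PROVED).  Seat `pub-ymgap-dag-n20-d` (R134), generation 3, module 6 (imports module 5 `…N20LCSAvgCellPeierls`, hence modules 1–3); kernel
theorems only (0 `def`, 0 `sorry`, standard axioms); COUNT-NEUTRAL.

WHY.  Module 3 (`N20LCSAvgExpMoment.localExpMoment_avgFun`) hard-wires the level-0 lattice Yang–Mills measure.  The node's road needs the same step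
AT EVERY LEVEL `j` and IN THE HISTORY TERM'S OWN STATE: once seat `pub-ymgap-dag-n20-c`'s residual (ii) supplies local exponential plaquette moments
for a RESTRICTED ∕ conditional level-`j` state `ν`, the moments of the AVERAGED field under that `ν` — i.e. «LCS-(j+1)» in the push-forward form of
`N20LCSPushforward.lcs_coarse_iff_fine` ∕ `N20LCSAtTStepOfRecord.lcs_piece_iff_fine` — must follow.  THIS FILE proves that implication ONCE, for an
arbitrary finite measure, any level, any dimension, with the constants of modules 1–3:

* §1 **`alpha_guard`** — the canonical threshold `α₀ := (δ_N ∕ (2(κ+1)))² ∕ (2N)`, `κ = ((d+2)L)²∕4`, satisfies the guard `κ·√(2Nα₀) < δ_N` and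
  `0 < α₀`;
* §2 **`localExpMoment_avgFun_of_moments`** — THE TRANSFER: standing range `j + 1 ≤ m + K`, `SU(N)`, `α > 0` under the guard, a finite measure `ν`
  on `GaugeField P j SU(N)`, `β ≥ 0`, a moment hypothesis `∀ a ∈ [0, a₀], ∀ X, ∫ exp(aβ·Σ_{q∈X}(1 − reTr U(∂q))) dν ≤ exp(C·a·#X)` (`C ≥ 0`); then for
  every `0 ≤ δ` with `δ·(A·M) ≤ a₀` and every finite `Q` of level-`(j+1)` plaquettes,
  `∫ exp(δβ·Σ_{p′∈Q}(1 − reTr Ū(∂p′))) dν ≤ exp(C·(A·M)·M·δ·#Q)`, where `A = 2N·(L² + 6((d+2)L)²)² + 2∕α` and `M = (2((d+3)L+2)+1)^d·d²`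
  (module 3 §2's summed letter pointwise, then the hypothesis at tilt `a = δ·A·M` on the region `⋃_{p′∈Q} boxRegion (emb p′₋) ((d+3)L+2)` of
  `≤ M·#Q` plaquettes);
* §3 **`measureReal_largeField_avgFun_le_of_moments`** — the Peierls consequence under a PROBABILITY measure `ν` with the moment hypothesis:
  `ν{∀ p′ ∈ Y, ε ≤ 1 − reTr Ū(∂p′)} ≤ exp(C·(A·M)·M·δ·#Y)·exp(−δβε·#Y)` for every admissible `δ`;
* §4 **`measureReal_largeFieldCells_avgFun_le_of_moments`** — per large-field CELL (module 5's one-witness-per-cell counting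
  `N20LCSAvgCellPeierls.measureReal_forall_exists_le_pow`): `ν{∀ c ∈ 𝒞, ∃ p′ ∈ cells c, ε ≤ 1 − reTr Ū(∂p′)} ≤ (m·exp(C·(A·M)·M·δ − δβε))^{#𝒞}`.

HONEST FRAMING.  A transfer RULE: its content for the node is exactly as strong as the moment hypothesis fed to it (today: the unrestricted level-0
measure, module 3; the restricted states are n20-c's (ii)); crude constants; nothing of Bałaban's asserted.  NE7b NOT PRINTED ∕ NOT PROVED;
(α)-instance 0∕1; N20 NOT discharged; typed 28∕28, discharged count untouched; one finite four-torus at fixed `ε` — NOT ℝ⁴, NOT infinite volume,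
NOT OS, NOT a mass gap, NOT Clay.

References: T. Bałaban, CMP 98 (1985) 17–51 [Balaban1985Averaging] (Prop. 1 (51) p.26); CMP 109 (1987) 249–301 [Balaban1987RG1] ((0.4) p.253);
CMP 122 (1989) 175–202 [Balaban1989LargeFieldI] ((0.1), (0.3)–(0.5) pp.175–177).
-/

noncomputable section

open scoped BigOperators Matrix.Norms.L2Operator

namespace Summit.QuantumFields.YangMills.BalabanUVNodes.N20LCSAvgTransfer

open MeasureTheory
open Literature.MathematicalPhysics.QuantumFieldTheory.Balaban1983to89
open T4Continuum T4ReflectionCone BlockAveraging ExpMeanLog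
open Summit.QuantumFields.YangMills.BalabanUVNodes.N20LCSAvgDominationRegion (boxRegion card_boxRegion_le)
open Summit.QuantumFields.YangMills.BalabanUVNodes.N20LCSAvgExpMoment (sum_one_sub_reTr_plaqHol_avgFun_le)
open Summit.QuantumFields.YangMills.BalabanUVNodes.N20LCSPushforward (card_biUnion_le_mul)
open Summit.QuantumFields.YangMills.BalabanUVNodes.N20LCSCoarseSparseness (measureReal_forall_le_le_of_expMoment)
open Summit.QuantumFields.YangMills.BalabanUVNodes.N20LCSAvgCellPeierls (measureReal_forall_exists_le_pow exp_mul_card_eq_pow)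

variable {n : Type*} [Fintype n] [DecidableEq n] [Nonempty n] {P : Params} {j : ℕ}

/-! ## §1 The canonical threshold under the guard -/

/-- **THE CANONICAL SMALL-FIELD THRESHOLD PASSES THE GUARD**: with `κ = ((d+2)L)²∕4` and `α₀ := (δ_N∕(2(κ+1)))²∕(2N)`, `0 < α₀` and
`κ·√(2N·α₀) = κ·δ_N∕(2(κ+1)) < δ_N`. [folklore] -/
theorem alpha_guard (P : Params) (n : Type*) [Fintype n] [DecidableEq n] [Nonempty n] :
    let κ : ℝ := (((P.d + 2) * P.L : ℕ) : ℝ) ^ 2 / 4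
    let α₀ : ℝ := (deltaSU n / (2 * (κ + 1))) ^ 2 / (2 * (Fintype.card n : ℝ))
    0 < α₀ ∧ κ * Real.sqrt (2 * (Fintype.card n : ℝ) * α₀) < deltaSU n := by
  intro κ α₀
  have hN : (0 : ℝ) < Fintype.card n := by exact_mod_cast Fintype.card_pos
  have hκ0 : 0 ≤ κ := by positivity
  have hδN := deltaSU_pos (n := n)
  refine ⟨by positivity, ?_⟩
  have hsqrt : Real.sqrt (2 * (Fintype.card n : ℝ) * α₀) = deltaSU n / (2 * (κ + 1)) := by
    show Real.sqrt (2 * (Fintype.card n : ℝ) * ((deltaSU n / (2 * (κ + 1))) ^ 2 / (2 * (Fintype.card n : ℝ)))) = _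
    rw [mul_div_cancel₀ _ (by positivity : (2 : ℝ) * (Fintype.card n : ℝ) ≠ 0)]
    exact Real.sqrt_sq (by positivity)
  rw [hsqrt]
  have h1 : κ / (2 * (κ + 1)) < 1 := by rw [div_lt_one (by positivity)]; linarith
  calc κ * (deltaSU n / (2 * (κ + 1))) = deltaSU n * (κ / (2 * (κ + 1))) := by ring
    _ < deltaSU n * 1 := mul_lt_mul_of_pos_left h1 hδN
    _ = deltaSU n := mul_one _

/-! ## §2 The transfer: moments of `ν` ⇒ moments of the averaged field under `ν` -/

/-- The plaquette-energy carrier `U ↦ exp(t·Σ_{q∈X}(1 − Re tr U(∂q)))` on `SU(N)` fields is measurable at every level. [folklore] -/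
theorem measurable_exp_plaqSum_gen (t : ℝ) (X : Finset (Plaq P j)) :
    Measurable fun U : GaugeField P j (Matrix.specialUnitaryGroup n ℂ) =>
      Real.exp (t * ∑ q ∈ X, (1 - reTr (GaugeField.plaqHol U q))) :=
  Real.measurable_exp.comp ((Finset.measurable_sum X fun q _ =>
    measurable_const.sub (RegularGaugeGroup.measurable_reTr.comp (Missing.measurable_plaqHol q))).const_mul t)

/-- … and bounded: `|exp(t·Σ_{q∈X}(1 − Re tr U(∂q)))| ≤ exp(|t|·2·#X)`. [folklore] -/
theorem abs_exp_plaqSum_gen_le (t : ℝ) (X : Finset (Plaq P j)) (U : GaugeField P j (Matrix.specialUnitaryGroup n ℂ)) :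
    |Real.exp (t * ∑ q ∈ X, (1 - reTr (GaugeField.plaqHol U q)))| ≤ Real.exp (|t| * (2 * X.card)) := by
  rw [Real.abs_exp]
  refine Real.exp_le_exp.2 ((le_abs_self _).trans ?_)
  rw [abs_mul]
  refine mul_le_mul_of_nonneg_left ?_ (abs_nonneg t)
  have h0 : ∀ q ∈ X, 0 ≤ 1 - reTr (GaugeField.plaqHol U q) := fun q _ => (RegularGaugeGroup.one_sub_reTr_mem_Icc _).1
  rw [abs_of_nonneg (Finset.sum_nonneg h0)]
  calc ∑ q ∈ X, (1 - reTr (GaugeField.plaqHol U q)) ≤ ∑ _q ∈ X, (2 : ℝ) :=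
        Finset.sum_le_sum fun q _ => (RegularGaugeGroup.one_sub_reTr_mem_Icc _).2
    _ = 2 * X.card := by rw [Finset.sum_const, nsmul_eq_mul]; ring

/-- **THE (LS) TRANSFER RULE FOR THE (0.4) AVERAGING** (standing range `j + 1 ≤ m + K`; `SU(N)`; any dimension; ANY finite measure `ν` on the
level-`j` fields): if `α > 0` passes the guard `(((d+2)L)²/4)·√(2Nα) < δ_N` and `ν` has local exponential plaquette moments
`∫ exp(aβ·Σ_{q∈X}(1 − reTr U(∂q))) dν ≤ exp(C·a·#X)` for all `0 ≤ a ≤ a₀` and all finite `X` (`β ≥ 0`, `C ≥ 0`), then for every `0 ≤ δ` with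
`δ·(A·M) ≤ a₀` (`A = 2N·(L² + 6((d+2)L)²)² + 2∕α`, `M = (2((d+3)L+2)+1)^d·d²`) and every finite `Q` of level-`(j+1)` plaquettes,
`∫ exp(δβ·Σ_{p′∈Q}(1 − reTr Ū(∂p′))) dν ≤ exp(C·(A·M)·M·δ·#Q)`, `Ū = avgFun expMeanLogSU U`.
[cite: Balaban1985Averaging, Prop. 1 (51) p.26; Balaban1987RG1, (0.4) p.253; Balaban1989LargeFieldI, (0.3)-(0.5) pp.176-177] -/
theorem localExpMoment_avgFun_of_moments (hj : j + 1 ≤ P.m + P.K) {α : ℝ} (hα : 0 < α)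
    (hguard : ((((P.d + 2) * P.L : ℕ) : ℝ) ^ 2 / 4) * Real.sqrt (2 * (Fintype.card n : ℝ) * α) < deltaSU n)
    (ν : Measure (GaugeField P j (Matrix.specialUnitaryGroup n ℂ))) [IsFiniteMeasure ν] {β : ℝ} (hβ : 0 ≤ β) {C a₀ : ℝ} (hC : 0 ≤ C)
    (hLS : ∀ a : ℝ, 0 ≤ a → a ≤ a₀ → ∀ X : Finset (Plaq P j),
      ∫ U, Real.exp (a * β * ∑ q ∈ X, (1 - reTr (GaugeField.plaqHol U q))) ∂ν ≤ Real.exp (C * a * X.card))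
    {δ : ℝ} (hδ0 : 0 ≤ δ)
    (hδ : δ * ((2 * (Fintype.card n : ℝ) * ((P.L : ℝ) ^ 2 + 6 * (((P.d + 2) * P.L : ℕ) : ℝ) ^ 2) ^ 2 + 2 / α) *
      (((2 * ((P.d + 3) * P.L + 2) + 1) ^ P.d * P.d ^ 2 : ℕ) : ℝ)) ≤ a₀)
    (Q : Finset (Plaq P (j + 1))) :
    ∫ U, Real.exp (δ * β * ∑ p ∈ Q, (1 - reTr (GaugeField.plaqHol (avgFun (expMeanLogSU (n := n)) U) p))) ∂ν ≤
      Real.exp (C * ((2 * (Fintype.card n : ℝ) * ((P.L : ℝ) ^ 2 + 6 * (((P.d + 2) * P.L : ℕ) : ℝ) ^ 2) ^ 2 + 2 / α) *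
        (((2 * ((P.d + 3) * P.L + 2) + 1) ^ P.d * P.d ^ 2 : ℕ) : ℝ)) *
        (((2 * ((P.d + 3) * P.L + 2) + 1) ^ P.d * P.d ^ 2 : ℕ) : ℝ) * δ * Q.card) := by
  classical
  set A : ℝ := 2 * (Fintype.card n : ℝ) * ((P.L : ℝ) ^ 2 + 6 * (((P.d + 2) * P.L : ℕ) : ℝ) ^ 2) ^ 2 + 2 / α with hA
  set M : ℕ := (2 * ((P.d + 3) * P.L + 2) + 1) ^ P.d * P.d ^ 2 with hM
  have hA0 : 0 < A := by positivity
  have hM0 : (0 : ℝ) ≤ (M : ℝ) := Nat.cast_nonneg _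
  -- the region and the tilt
  set R : Plaq P (j + 1) → Finset (Plaq P j) := fun p => boxRegion (emb p.src) ((P.d + 3) * P.L + 2) with hR
  set X : Finset (Plaq P j) := Q.biUnion R with hX
  set a : ℝ := δ * (A * M) with ha
  have ha0 : 0 ≤ a := by positivity
  have haa₀ : a ≤ a₀ := hδ
  -- pointwise
  have hpt : ∀ U : GaugeField P j (Matrix.specialUnitaryGroup n ℂ),
      δ * β * ∑ p ∈ Q, (1 - reTr (GaugeField.plaqHol (avgFun (expMeanLogSU (n := n)) U) p)) ≤
        a * β * ∑ q ∈ X, (1 - reTr (GaugeField.plaqHol U q)) := by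
    intro U
    have h := sum_one_sub_reTr_plaqHol_avgFun_le (n := n) hj hα hguard U Q
    rw [← hM] at h
    have hδβ : 0 ≤ δ * β := mul_nonneg hδ0 hβ
    calc δ * β * ∑ p ∈ Q, (1 - reTr (GaugeField.plaqHol (avgFun (expMeanLogSU (n := n)) U) p))
        ≤ δ * β * (A * M * ∑ q ∈ X, (1 - reTr (GaugeField.plaqHol U q))) := mul_le_mul_of_nonneg_left h hδβ
      _ = a * β * ∑ q ∈ X, (1 - reTr (GaugeField.plaqHol U q)) := by rw [ha]; ring
  -- the dominating carrier is integrable (bounded, measurable, finite measure)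
  have hg_int : Integrable (fun U : GaugeField P j (Matrix.specialUnitaryGroup n ℂ) =>
      Real.exp (a * β * ∑ q ∈ X, (1 - reTr (GaugeField.plaqHol U q)))) ν := by
    refine (integrable_const (Real.exp (|a * β| * (2 * X.card)))).mono'
      (measurable_exp_plaqSum_gen (a * β) X).aestronglyMeasurable (ae_of_all _ fun U => ?_)
    rw [Real.norm_eq_abs]
    exact abs_exp_plaqSum_gen_le (a * β) X U
  have hmono : ∫ U, Real.exp (δ * β * ∑ p ∈ Q, (1 - reTr (GaugeField.plaqHol (avgFun (expMeanLogSU (n := n)) U) p))) ∂ν ≤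
      ∫ U, Real.exp (a * β * ∑ q ∈ X, (1 - reTr (GaugeField.plaqHol U q))) ∂ν :=
    integral_mono_of_nonneg (ae_of_all _ fun U => (Real.exp_pos _).le) hg_int
      (ae_of_all _ fun U => Real.exp_le_exp.mpr (hpt U))
  have hhyp := hLS a ha0 haa₀ X
  have hXcard : (X.card : ℝ) ≤ (M : ℝ) * Q.card := by
    have h := card_biUnion_le_mul Q R M fun p _ => by
      have := card_boxRegion_le (emb p.src) ((P.d + 3) * P.L + 2)
      rwa [← hM] at this
    exact_mod_cast h
  calc ∫ U, Real.exp (δ * β * ∑ p ∈ Q, (1 - reTr (GaugeField.plaqHol (avgFun (expMeanLogSU (n := n)) U) p))) ∂ν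
      ≤ ∫ U, Real.exp (a * β * ∑ q ∈ X, (1 - reTr (GaugeField.plaqHol U q))) ∂ν := hmono
    _ ≤ Real.exp (C * a * X.card) := hhyp
    _ ≤ Real.exp (C * a * ((M : ℝ) * Q.card)) := Real.exp_le_exp.mpr (mul_le_mul_of_nonneg_left hXcard (by positivity))
    _ = Real.exp (C * (A * M) * M * δ * Q.card) := by rw [ha]; ring_nf

/-! ## §3 The Peierls consequence under a probability state with the moment hypothesis -/

/-- Integrability of the averaged carrier under a finite measure. [folklore] -/
theorem integrable_exp_plaqSum_avgFun_finite (ν : Measure (GaugeField P j (Matrix.specialUnitaryGroup n ℂ))) [IsFiniteMeasure ν]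
    (t : ℝ) (Q : Finset (Plaq P (j + 1))) :
    Integrable (fun U : GaugeField P j (Matrix.specialUnitaryGroup n ℂ) =>
      Real.exp (t * ∑ p ∈ Q, (1 - reTr (GaugeField.plaqHol (avgFun (expMeanLogSU (n := n)) U) p)))) ν := by
  have hmeas : Measurable fun U : GaugeField P j (Matrix.specialUnitaryGroup n ℂ) =>
      Real.exp (t * ∑ p ∈ Q, (1 - reTr (GaugeField.plaqHol (avgFun (expMeanLogSU (n := n)) U) p))) :=
    (measurable_exp_plaqSum_gen (n := n) (P := P) (j := j + 1) t Q).comp (measurable_avgFun (expMeanLogSU (n := n)) measurable_expMeanLogSU_E)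
  refine (integrable_const (Real.exp (|t| * (2 * Q.card)))).mono' hmeas.aestronglyMeasurable (ae_of_all _ fun U => ?_)
  rw [Real.norm_eq_abs]
  exact abs_exp_plaqSum_gen_le t Q _

/-- **COARSE LARGE-FIELD SPARSENESS UNDER ANY PROBABILITY STATE WITH LOCAL EXPONENTIAL PLAQUETTE MOMENTS** (standing range; `SU(N)`; any
dimension): under the hypotheses of `localExpMoment_avgFun_of_moments` with `ν` a probability measure, for every admissible `δ`, every threshold `ε`
and every finite `Y` of level-`(j+1)` plaquettes, `ν{∀ p′ ∈ Y, ε ≤ 1 − reTr Ū(∂p′)} ≤ exp(C·(A·M)·M·δ·#Y)·exp(−δβε·#Y)` (Markov on §2).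
[cite: Balaban1989LargeFieldI, (0.1) p.175; Balaban1987RG1, (0.4) p.253] -/
theorem measureReal_largeField_avgFun_le_of_moments (hj : j + 1 ≤ P.m + P.K) {α : ℝ} (hα : 0 < α)
    (hguard : ((((P.d + 2) * P.L : ℕ) : ℝ) ^ 2 / 4) * Real.sqrt (2 * (Fintype.card n : ℝ) * α) < deltaSU n)
    (ν : Measure (GaugeField P j (Matrix.specialUnitaryGroup n ℂ))) [IsProbabilityMeasure ν] {β : ℝ} (hβ : 0 ≤ β) {C a₀ : ℝ} (hC : 0 ≤ C)
    (hLS : ∀ a : ℝ, 0 ≤ a → a ≤ a₀ → ∀ X : Finset (Plaq P j),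
      ∫ U, Real.exp (a * β * ∑ q ∈ X, (1 - reTr (GaugeField.plaqHol U q))) ∂ν ≤ Real.exp (C * a * X.card))
    {δ : ℝ} (hδ0 : 0 ≤ δ)
    (hδ : δ * ((2 * (Fintype.card n : ℝ) * ((P.L : ℝ) ^ 2 + 6 * (((P.d + 2) * P.L : ℕ) : ℝ) ^ 2) ^ 2 + 2 / α) *
      (((2 * ((P.d + 3) * P.L + 2) + 1) ^ P.d * P.d ^ 2 : ℕ) : ℝ)) ≤ a₀)
    (ε : ℝ) (Y : Finset (Plaq P (j + 1))) :
    ν.real {U | ∀ p ∈ Y, ε ≤ 1 - reTr (GaugeField.plaqHol (avgFun (expMeanLogSU (n := n)) U) p)} ≤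
      Real.exp (C * ((2 * (Fintype.card n : ℝ) * ((P.L : ℝ) ^ 2 + 6 * (((P.d + 2) * P.L : ℕ) : ℝ) ^ 2) ^ 2 + 2 / α) *
        (((2 * ((P.d + 3) * P.L + 2) + 1) ^ P.d * P.d ^ 2 : ℕ) : ℝ)) *
        (((2 * ((P.d + 3) * P.L + 2) + 1) ^ P.d * P.d ^ 2 : ℕ) : ℝ) * δ * Y.card) * Real.exp (-(δ * β * ε * Y.card)) := by
  have hmarkov := measureReal_forall_le_le_of_expMoment ν Y
    (fun p U => 1 - reTr (GaugeField.plaqHol (avgFun (expMeanLogSU (n := n)) U) p)) (ε := ε) hδ0 hβ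
    (integrable_exp_plaqSum_avgFun_finite ν (δ * β) Y)
  exact hmarkov.trans (mul_le_mul_of_nonneg_right
    (localExpMoment_avgFun_of_moments (n := n) hj hα hguard ν hβ hC hLS hδ0 hδ Y) (Real.exp_pos _).le)


/-! ## §4 Per large-field cell, under a probability state with the moment hypothesis (module 5's counting) -/

/-- **THE PEIERLS WEIGHT PER LARGE-FIELD CELL OF `Ū` UNDER ANY PROBABILITY STATE WITH LOCAL EXPONENTIAL PLAQUETTE MOMENTS**: under the hypotheses of
`measureReal_largeField_avgFun_le_of_moments`, for every finite family `𝒞` of cells with pairwise disjoint sets `cells c` of at most `m` level-`(j+1)`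
plaquettes, `ν{∀ c ∈ 𝒞, ∃ p′ ∈ cells c, ε ≤ 1 − reTr Ū(∂p′)} ≤ (m·exp(C·(A·M)·M·δ − δβε))^{#𝒞}` (module 5's `measureReal_forall_exists_le_pow`).
[cite: Balaban1989LargeFieldI, (0.1) p.175; Balaban1987RG1, (0.4) p.253] -/
theorem measureReal_largeFieldCells_avgFun_le_of_moments (hj : j + 1 ≤ P.m + P.K) {α : ℝ} (hα : 0 < α)
    (hguard : ((((P.d + 2) * P.L : ℕ) : ℝ) ^ 2 / 4) * Real.sqrt (2 * (Fintype.card n : ℝ) * α) < deltaSU n)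
    (ν : Measure (GaugeField P j (Matrix.specialUnitaryGroup n ℂ))) [IsProbabilityMeasure ν] {β : ℝ} (hβ : 0 ≤ β) {C a₀ : ℝ} (hC : 0 ≤ C)
    (hLS : ∀ a : ℝ, 0 ≤ a → a ≤ a₀ → ∀ X : Finset (Plaq P j),
      ∫ U, Real.exp (a * β * ∑ q ∈ X, (1 - reTr (GaugeField.plaqHol U q))) ∂ν ≤ Real.exp (C * a * X.card))
    {δ : ℝ} (hδ0 : 0 ≤ δ)
    (hδ : δ * ((2 * (Fintype.card n : ℝ) * ((P.L : ℝ) ^ 2 + 6 * (((P.d + 2) * P.L : ℕ) : ℝ) ^ 2) ^ 2 + 2 / α) *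
      (((2 * ((P.d + 3) * P.L + 2) + 1) ^ P.d * P.d ^ 2 : ℕ) : ℝ)) ≤ a₀)
    (ε : ℝ) {κ : Type*} [DecidableEq κ] (𝒞 : Finset κ) (cells : κ → Finset (Plaq P (j + 1))) (m : ℕ)
    (hm : ∀ c ∈ 𝒞, (cells c).card ≤ m) (hdisj : ∀ c₁ ∈ 𝒞, ∀ c₂ ∈ 𝒞, c₁ ≠ c₂ → Disjoint (cells c₁) (cells c₂)) :
    ν.real {U | ∀ c ∈ 𝒞, ∃ p ∈ cells c, ε ≤ 1 - reTr (GaugeField.plaqHol (avgFun (expMeanLogSU (n := n)) U) p)} ≤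
      ((m : ℝ) * Real.exp (C * ((2 * (Fintype.card n : ℝ) * ((P.L : ℝ) ^ 2 + 6 * (((P.d + 2) * P.L : ℕ) : ℝ) ^ 2) ^ 2 + 2 / α) *
        (((2 * ((P.d + 3) * P.L + 2) + 1) ^ P.d * P.d ^ 2 : ℕ) : ℝ)) *
        (((2 * ((P.d + 3) * P.L + 2) + 1) ^ P.d * P.d ^ 2 : ℕ) : ℝ) * δ - δ * β * ε)) ^ 𝒞.card := by
  classical
  refine measureReal_forall_exists_le_pow ν
    (fun p => {U : GaugeField P j (Matrix.specialUnitaryGroup n ℂ) |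
      ε ≤ 1 - reTr (GaugeField.plaqHol (avgFun (expMeanLogSU (n := n)) U) p)})
    𝒞 cells hm hdisj (Real.exp_pos _).le fun Y => ?_
  rw [← exp_mul_card_eq_pow]
  exact measureReal_largeField_avgFun_le_of_moments (n := n) hj hα hguard ν hβ hC hLS hδ0 hδ ε Y

end Summit.QuantumFields.YangMills.BalabanUVNodes.N20LCSAvgTransfer

end
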